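import Summits.BirchSwinnertonDyer.BirchSwinnertonDyer.Theses.TwistFamilyManinDescent
import Literature.NumberTheory.EllipticCurves.ModularCurveManinConstantProofs

/-!
# Étale-quotient depth / crossed-congruence bound — First-lemma sketch (crux stmt-BirchSwinnertonDyer-25138)

Seat-1 crux-idea cards `etale-quotient-depth` (card 1, g0) and `crossed-congruence-bound` (card 2, g0) of
crux `TwistFamilyManinDescent.EisensteinAdditiveManinResidual` cite first lemmas from the g0 session files
`Sketch.lean` / `Sketch2.lean`; those session folders no longer exist.  This file REBUILDS them (g6) as a
published crux workfile, in the CALIBRATED form of `Ideas/etale-quotient-depth-calibration.md` §§3, 7: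
the Manin-exponent formula (MEF) of card 1 is an UPPER BOUND `v_p(c_E) ≤ ⌈drop − θ⌉` (exact only up to
the sub-side cokernel term `u = length coker(Cot 𝒥₀(N) → Cot ℰ)`, = -imc's `k_p`), which is all the
sufficient criterion `drop ≤ θ ⇒ p ∤ c_E` needs.

Contents (all kernel-checked, no `sorry`):
* `depth_eq_floor_of_tame_sandwich`, `avg_excess_le` — the floor-rounding of Edixhoven's tame filtration
  (jumps `i/e`, `ε₀ = 0`, `ε_i ∈ {0,1}`): `t_Λ ≤ t_M ≤ t_Λ + (e−1)/e ⇒ t_Λ = ⌊t_M⌋`; the ramification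
  index `e` drops out.
* `LocalDepthDatum D p` — the POSITED interface of card 1 (fields `drop θ : ℚ`, `0 ≤ drop`,
  `|θ| ≤ 1/(p−1)`, and the calibrated bound `v_p(c) ≤ ⌈drop − θ⌉`).  Its CONSTRUCTION on the corner rows
  (card 1 steps 1–4: ČNS + BLR/ℤ_p + tame sandwich + Fargues–Scholze–Weinstein integral Hodge–Tate) is
  stub S1 of any line built on the card and is NOT a field: existence is never smuggled in.
* `LocalDepthDatum.not_dvd_maninConstant_of_drop_le` — `drop ≤ θ ⇒ p ∤ c` (proved from the fields and
  `ModularParametrizationData.maninConstant_ne_zero_holds`).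
* `CornerDropBound`, `DropBoundOnReducibleRows` and the proved links
  `eisensteinCorner_of_cornerDropBound : CornerDropBound → EisensteinCornerManinResidual` (stmt-26289),
  `crux_of_dropBound : DropBoundOnReducibleRows → EisensteinAdditiveManinResidual` (stmt-25138).
* namespace `CrossedPartnerLaw` (card 2's toy first lemmas): the principal-series inertial exponent pair
  `{1 + k(p−1)/e, −k(p−1)/e} ⊂ ℤ/(p−1)`, the decide-checked corner tables at `p = 5, 7` (which tame
  parameters are ALIGNED with a `p`-unramified partner, i.e. give `{0,1}`), the isotypic-projection step
  `map_range_le_of_intertwine`, and the parametrised statement `CrossedCongruenceBound AlignedPacket`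
  (mod S1: an aligned packet gives a `LocalDepthDatum` with `drop ≤ θ`).

BSD is not proved by any of this; Manin `c = 1` is not proved by this.
-/

noncomputable section

set_option linter.dupNamespace false

open scoped MatrixGroups ModularForm

open CongruenceSubgroup WeierstrassCurve Literature.NumberTheory.EllipticCurves.ModularForms

namespace Summit.BirchSwinnertonDyer.BirchSwinnertonDyer.Cruxes.EisensteinAdditiveManinResidual.EtaleQuotientDepth

/-! ### The floor-rounding of the tame sandwich (card 1 step 2) -/

/-- **Tame sandwich ⇒ floor.** If an integer depth `tΛ` and a rational depth `tM` satisfy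
`tΛ ≤ tM ≤ tΛ + (e−1)/e` for some `e ≥ 1`, then `tΛ = ⌊tM⌋`: the ramification index drops out. -/
theorem depth_eq_floor_of_tame_sandwich {e : ℕ} (he : 0 < e) (tΛ : ℤ) (tM : ℚ)
    (h1 : (tΛ : ℚ) ≤ tM) (h2 : tM ≤ tΛ + ((e : ℚ) - 1) / e) : tΛ = ⌊tM⌋ := by
  symm
  rw [Int.floor_eq_iff]
  refine ⟨h1, ?_⟩
  have he' : (0 : ℚ) < e := by exact_mod_cast he
  have hlt : ((e : ℚ) - 1) / e < 1 := by
    rw [div_lt_one he']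
    linarith
  linarith

/-- **Average excess of the jump pattern.** With `ε 0 = 0` and `ε i ≤ 1`, the average
`(∑_{i<e} ε i)/e` lies in `[0, (e−1)/e]` — the width of the tame sandwich. -/
theorem avg_excess_le {e : ℕ} (he : 0 < e) (ε : ℕ → ℕ) (h0 : ε 0 = 0) (h1 : ∀ i, ε i ≤ 1) :
    0 ≤ ((∑ i ∈ Finset.range e, ε i : ℕ) : ℚ) / e ∧
      ((∑ i ∈ Finset.range e, ε i : ℕ) : ℚ) / e ≤ ((e : ℚ) - 1) / e := by
  obtain ⟨n, rfl⟩ : ∃ n, e = n + 1 := ⟨e - 1, by omega⟩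
  have hsum : ∑ i ∈ Finset.range (n + 1), ε i ≤ n := by
    rw [Finset.sum_range_succ', h0, add_zero]
    calc ∑ i ∈ Finset.range n, ε (i + 1) ≤ ∑ _i ∈ Finset.range n, 1 :=
          Finset.sum_le_sum fun i _ => h1 (i + 1)
      _ = n := by simp
  have he' : (0 : ℚ) < ((n + 1 : ℕ) : ℚ) := by exact_mod_cast he
  refine ⟨div_nonneg (by exact_mod_cast Nat.zero_le _) he'.le, ?_⟩
  have hq : ((∑ i ∈ Finset.range (n + 1), ε i : ℕ) : ℚ) ≤ ((n + 1 : ℕ) : ℚ) - 1 := by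
    have : ((∑ i ∈ Finset.range (n + 1), ε i : ℕ) : ℚ) ≤ (n : ℚ) := by exact_mod_cast hsum
    push_cast at this ⊢
    linarith
  gcongr

/-! ### The posited local depth datum (card 1 (iii), calibrated) -/

/-- **INTERFACE (posited object; construction = stub S1, not a field).**  For a parametrisation datum `D`
of level `N` and a prime `p`: `drop` = the `𝔪`-adic congruence depth of `f` NOT carried by the
multiplicative/étale-quotient filtration of the fixed-part Tate module (card 1 step 4), `θ` = the integral
Hodge–Tate defect of Fargues–Scholze–Weinstein (|θ| ≤ 1/(p−1), step 3), and the CALIBRATED Manin-exponent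
bound `v_p(c_E) ≤ ⌈drop − θ⌉` (calibration §3: equality holds only up to `−u`, `u` the sub-side cokernel
length; the bound is what survives and what the criterion below uses). -/
structure LocalDepthDatum {N : ℕ} [NeZero N] {W : WeierstrassCurve ℚ}
    (D : ModularParametrizationData W N) (p : ℕ) where
  /-- the unfiltered congruence depth of `f` (step 4), a non-negative rational of denominator `e`. -/
  drop : ℚ
  /-- the integral Hodge–Tate defect (step 3). -/
  θ : ℚ
  drop_nonneg : 0 ≤ drop
  θ_le : θ ≤ 1 / ((p : ℚ) - 1)
  neg_le_θ : -(1 / ((p : ℚ) - 1)) ≤ θ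
  /-- (MEF′), calibrated: `v_p(c_E) ≤ ⌈drop − θ⌉`. -/
  padicValInt_le_ceil : (padicValInt p D.maninConstant : ℤ) ≤ ⌈drop - θ⌉

namespace LocalDepthDatum

variable {N : ℕ} [NeZero N] {W : WeierstrassCurve ℚ} {D : ModularParametrizationData W N} {p : ℕ}

/-- **The criterion** (card 1 (iv)): `drop ≤ θ ⇒ p ∤ c_E`.  From the calibrated bound:
`⌈drop − θ⌉ ≤ 0`, so `v_p(c) = 0`, and `c ≠ 0` (`maninConstant_ne_zero_holds`). -/
theorem not_dvd_maninConstant_of_drop_le (hp : p.Prime) (L : LocalDepthDatum D p) (h : L.drop ≤ L.θ) :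
    ¬ (p : ℤ) ∣ D.maninConstant := by
  haveI : Fact p.Prime := ⟨hp⟩
  have hceil : ⌈L.drop - L.θ⌉ ≤ 0 := Int.ceil_le.mpr (by push_cast; linarith)
  have hv : padicValInt p D.maninConstant = 0 := by
    have := L.padicValInt_le_ceil
    omega
  have hc : D.maninConstant ≠ 0 := D.maninConstant_ne_zero_holds
  intro hdvd
  rcases (padicValInt_dvd_iff 1 D.maninConstant).mp (by simpa using hdvd) with h0 | h1
  · exact hc h0
  · omega

/-- Conversely the interface is CONSISTENT with `p ∣ c` only when `drop > θ` (contrapositive bookkeeping). -/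
theorem θ_lt_drop_of_dvd (hp : p.Prime) (L : LocalDepthDatum D p) (h : (p : ℤ) ∣ D.maninConstant) :
    L.θ < L.drop := by
  by_contra hle
  exact L.not_dvd_maninConstant_of_drop_le hp (not_lt.mp hle) h

end LocalDepthDatum

/-! ### The corner statements and their proved links to the route -/

/-- **(CDB) `CornerDropBound`** (card 1 (v)): on every Eisenstein additive row at `p ∈ {5, 7, 13}` the local
depth datum exists with `drop ≤ θ`.  (= S1-construction ∧ S2 = (MULT) of the card; E-sighted.) -/
def CornerDropBound : Prop :=
  ∀ (W : WeierstrassCurve ℚ) [W.IsElliptic] {N : ℕ} [NeZero N] (D : ModularParametrizationData W N)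
    (p : ℕ), p.Prime → (p = 5 ∨ p = 7 ∨ p = 13) → p ^ 2 ∣ N → ¬ W.HasIrreducibleModPGaloisRep p →
    ∃ L : LocalDepthDatum D p, L.drop ≤ L.θ

/-- The same on ALL reducible additive rows (covers the `p = 163 ∧ 2⁶ ∣ N` CM corner of the crux too). -/
def DropBoundOnReducibleRows : Prop :=
  ∀ (W : WeierstrassCurve ℚ) [W.IsElliptic] {N : ℕ} [NeZero N] (D : ModularParametrizationData W N)
    (p : ℕ), p.Prime → p ^ 2 ∣ N → ¬ W.HasIrreducibleModPGaloisRep p →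
    ∃ L : LocalDepthDatum D p, L.drop ≤ L.θ

theorem cornerDropBound_of_dropBoundOnReducibleRows (h : DropBoundOnReducibleRows) : CornerDropBound :=
  fun W _ _ _ D p hp _ hN hred => h W D p hp hN hred

/-- **Link to stmt-26289** (`EisensteinCornerManinResidual`, the `p ∈ {5,7}` non-Ray57 corner). PROVED. -/
theorem eisensteinCorner_of_cornerDropBound (h : CornerDropBound) :
    Theses.TwistFamilyManinDescent.EisensteinCornerManinResidual := by
  intro _ _ _ _ W _ _ N _ D p hp hp57 _ hN hred _ _
  obtain ⟨L, hL⟩ := h W D p hp (hp57.elim Or.inl fun h7 => Or.inr (Or.inl h7)) hN hred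
  exact L.not_dvd_maninConstant_of_drop_le hp hL

/-- **Link to the crux stmt-25138** (`EisensteinAdditiveManinResidual`). PROVED. -/
theorem crux_of_dropBound (h : DropBoundOnReducibleRows) :
    Theses.TwistFamilyManinDescent.EisensteinAdditiveManinResidual := by
  intro _ _ _ _ W _ _ N _ D p hp _ hN hred _ _
  obtain ⟨L, hL⟩ := h W D p hp hN hred
  exact L.not_dvd_maninConstant_of_drop_le hp hL

/-! ### Card 2 (`crossed-congruence-bound`): toy first lemmas of the crossed-partner law -/

namespace CrossedPartnerLaw

/-- Principal-series tame parameter at `p` with `e ∣ p − 1`: the two inertial exponents of `ρ̄^{ss}|I_p`,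
`ω^{1 + k(p−1)/e} ⊕ ω^{−k(p−1)/e}`, as a pair in `ℤ/(p−1)`. -/
def inertialExponents (p e k : ℕ) : ZMod (p - 1) × ZMod (p - 1) :=
  (((1 + (p - 1) / e * k : ℕ) : ZMod (p - 1)), -(((p - 1) / e * k : ℕ) : ZMod (p - 1)))

/-- A tame parameter is ALIGNED when its exponent pair is `{0, 1}` — the pair of a `p`-unramified
(finite-flat / ordinary, `p`-old or `p`-semistable) congruence partner; otherwise it is CROSSED. -/
def IsAligned (p e k : ℕ) : Prop :=
  inertialExponents p e k ∈ ({(0, 1), (1, 0)} : Finset (ZMod (p - 1) × ZMod (p - 1)))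

/-- `p = 5`, ordinary corner `e = 4` (types III/III*), parameters `k ∈ {1, 3}`: exactly the `ω^{-1}`-branch
`k = 3` is aligned (its crossed partners are the 5-old / 5-semistable forms), `k = 1` is crossed. -/
theorem corner_five_table : IsAligned 5 4 3 ∧ ¬ IsAligned 5 4 1 := by
  unfold IsAligned inertialExponents; decide

/-- `p = 7`: the `e = 6` branch `k = 5` is aligned, `k = 1` is not; the `e = 3` parameters `k ∈ {1, 2}`
(types IV/IV*) are never aligned. -/
theorem corner_seven_table :
    IsAligned 7 6 5 ∧ ¬ IsAligned 7 6 1 ∧ ¬ IsAligned 7 3 1 ∧ ¬ IsAligned 7 3 2 := by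
  unfold IsAligned inertialExponents; decide

/-- `p = 13`: `e = 12`, `k = 11` aligned; `e ∈ {3, 4, 6}` samples crossed. -/
theorem corner_thirteen_table :
    IsAligned 13 12 11 ∧ ¬ IsAligned 13 4 1 ∧ ¬ IsAligned 13 3 1 ∧ ¬ IsAligned 13 6 1 := by
  unfold IsAligned inertialExponents; decide

/-- The packet dichotomy is decidable bookkeeping: every parameter is aligned or crossed. -/
theorem aligned_or_crossed (p e k : ℕ) : IsAligned p e k ∨ ¬ IsAligned p e k := em _

/-- **Isotypic-projection step.** If `T` intertwines endomorphisms `ε` of `V` and `ε'` of `V'`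
(`T ∘ ε = ε' ∘ T`), then `T` maps the image of `ε` into the image of `ε'` — the step
`pr_f(e_ζ T) ⊆ e_ζ pr_f(T)` of the card with `ε = e_ζ` an idempotent of the tame inertia algebra. -/
theorem map_range_le_of_intertwine {R V V' : Type*} [CommRing R] [AddCommGroup V] [Module R V]
    [AddCommGroup V'] [Module R V'] (T : V →ₗ[R] V') (ε : V →ₗ[R] V) (ε' : V' →ₗ[R] V')
    (h : T.comp ε = ε'.comp T) :
    Submodule.map T (LinearMap.range ε) ≤ LinearMap.range ε' := by
  rw [← LinearMap.range_comp, h]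
  exact LinearMap.range_comp_le_range T ε'

/-- **(CCB) mod S1, parametrised by the posited packet predicate** (definition request D3 of the card: the
`𝔪`-adic packet of `f` with each member's potential type at `p`): an ALIGNED packet yields a local depth
datum with `drop ≤ θ` on the Eisenstein corner rows. -/
def CrossedCongruenceBound
    (AlignedPacket : ∀ {N : ℕ} [NeZero N] {W : WeierstrassCurve ℚ},
      ModularParametrizationData W N → ℕ → Prop) : Prop :=
  ∀ (W : WeierstrassCurve ℚ) [W.IsElliptic] {N : ℕ} [NeZero N] (D : ModularParametrizationData W N)
    (p : ℕ), p.Prime → (p = 5 ∨ p = 7 ∨ p = 13) → p ^ 2 ∣ N → ¬ W.HasIrreducibleModPGaloisRep p →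
    AlignedPacket D p → ∃ L : LocalDepthDatum D p, L.drop ≤ L.θ

/-- (CCB) ∧ «every corner packet is aligned» ⇒ (CDB). PROVED (bookkeeping). -/
theorem cornerDropBound_of_crossedCongruenceBound
    {AlignedPacket : ∀ {N : ℕ} [NeZero N] {W : WeierstrassCurve ℚ},
      ModularParametrizationData W N → ℕ → Prop}
    (hccb : CrossedCongruenceBound AlignedPacket)
    (hall : ∀ (W : WeierstrassCurve ℚ) [W.IsElliptic] {N : ℕ} [NeZero N]
      (D : ModularParametrizationData W N) (p : ℕ), p.Prime → (p = 5 ∨ p = 7 ∨ p = 13) → p ^ 2 ∣ N →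
      ¬ W.HasIrreducibleModPGaloisRep p → AlignedPacket D p) :
    CornerDropBound :=
  fun W _ _ _ D p hp h57 hN hred => hccb W D p hp h57 hN hred (hall W D p hp h57 hN hred)

end CrossedPartnerLaw

end Summit.BirchSwinnertonDyer.BirchSwinnertonDyer.Cruxes.EisensteinAdditiveManinResidual.EtaleQuotientDepth

end
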